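import Summits.AnomalousDissipation.AnomalousDissipation.Theorems.SolenoidalFractalHomogenisationLagrangianStepSidebandQSKernel
import Summits.AnomalousDissipation.AnomalousDissipation.Theorems.SolenoidalFractalHomogenisationLagrangianStepSidebandSlotTime
import Summits.AnomalousDissipation.AnomalousDissipation.Theorems.SolenoidalFractalHomogenisationLagrangianStepD1ResidueCertDefs
import HarnessLib

/-!
# K1L_D `stub_D1_residueTail` (registry v17, stmt-AnomalousDissipation-27980) — lane A1 brick D-2: THE DOUBLE INTEGRAL OF THE BLOCK SEMIGROUP OVER TWO
# CONSECUTIVE SLOTS IS `T⁻¹ • pairResp · P̂` (helper; `--supports stmt-AnomalousDissipation-27980`)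

Summits-side helper file of route `SolenoidalFractalHomogenisation` (prover seat `ad-sawtooth-k1loc-p1` g13; lane A of the tail certificate
`Lines/onelevel-D1-tail-cert.md`, case D «colinear adjacent pair»).  Everything proved; no definitions, no named facts, no sorry.  Entrywise (scalar)
integrals only, as in `…SidebandQSKernel`.  With `a = trapezoid 0 1 ρ`, `cmat A = Matrix.toEuclideanCLM (A.map (↑))` (inline):
* `double_integral_pair_subst` — pickup slot `[t₀, t₀+L]` right after the source slot `[t₀−L, t₀]` (equal lengths):
  `∫_{t₀}^{t₀+L} trap_{t₀}(t) • ∫_{t₀−L}^{t₀} trap_{t₀−L}(u) • K(t−u) du dt = L • L • ∫₀¹ a(σ) • ∫₀¹ a(x) • K(L(1+σ−x)) dx dσ`;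
* `pair_integral_integral_ofReal_mul`, `pair_integral_integral_sum_sum` — casts and finite sums through the two-slot double integral;
* **`pair_integral_integral_exp_blockGen_eq`** — for `𝔸 = ν•S`, a lattice phase `P`, a slot length `L`, `T = L·4π²ν|m|² ≠ 0`:
  `∫₀¹ a(σ) • ∫₀¹ a(x) • exp((L(1+σ−x))•(blockGen (ν•S) γ₁ m)↾ℝ)(P_m v) dx dσ = (T⁻¹ : ℂ) • cmat(pairResp ρ T (regBlock S m̂) · projPerp m̂) v`
  (`D1ResidueCert.pairResp`) — the fresh–fresh pair-memory kernel of `M_{2l+1,2l}` IS the certified `pairResp` up to `T⁻¹`.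
NOT a proof of any registered stub, of the crux, or of anomalous dissipation; rung leaf F-D1 infrastructure.
-/

set_option linter.dupNamespace false

noncomputable section

namespace Summit.AnomalousDissipation.AnomalousDissipation.Theorems.SolenoidalFractalHomogenisation.LagrangianStep.Sideband

open Set MeasureTheory Complex Matrix intervalIntegral
open scoped InnerProductSpace
open Literature.Analysis Literature.Analysis.FunctionSpaces Literature.Analysis.FunctionSpaces.Torus
open Literature.Analysis.FluidPDE Literature.Analysis.FluidPDE.Torus Literature.Analysis.FluidPDE.LatticeShear
open Summit.AnomalousDissipation.AnomalousDissipation.Theorems.SolenoidalFractalHomogenisation.LagrangianStep.D1ResidueCert (pairResp)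

variable {k₀ : ℕ}

/-! ## §1 The two-slot substitution -/

variable {E : Type*} [NormedAddCommGroup E] [NormedSpace ℝ E]

/-- **Two-slot substitution** for a lag kernel `K` (source slot `[t₀ − L, t₀]`, pickup slot `[t₀, t₀ + L]`, common length `L > 0`):
`∫_{t₀}^{t₀+L} trap_{t₀}(t) • ∫_{t₀−L}^{t₀} trap_{t₀−L}(u) • K(t − u) du dt = L • L • ∫₀¹ a(σ) • ∫₀¹ a(x) • K(L(1+σ−x)) dx dσ`. [folklore] -/
theorem double_integral_pair_subst {L : ℝ} (hL : 0 < L) (t₀ ρ : ℝ) (K : ℝ → E) :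
    ∫ t in t₀..t₀ + L, LatticeWord.trapezoid t₀ L ρ t • ∫ u in (t₀ - L)..t₀, LatticeWord.trapezoid (t₀ - L) L ρ u • K (t - u) =
      L • L • ∫ σ in (0:ℝ)..1, LatticeWord.trapezoid 0 1 ρ σ • ∫ x in (0:ℝ)..1, LatticeWord.trapezoid 0 1 ρ x • K (L * (1 + σ - x)) := by
  have hout := integral_slot_subst (fun t => LatticeWord.trapezoid t₀ L ρ t • ∫ u in (t₀ - L)..t₀, LatticeWord.trapezoid (t₀ - L) L ρ u • K (t - u)) t₀ L 1
  rw [mul_one] at hout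
  rw [hout]
  congr 1
  rw [← intervalIntegral.integral_smul]
  refine intervalIntegral.integral_congr fun σ _ => ?_
  show LatticeWord.trapezoid t₀ L ρ (t₀ + L * σ) • ∫ u in (t₀ - L)..t₀, LatticeWord.trapezoid (t₀ - L) L ρ u • K (t₀ + L * σ - u) =
    L • (LatticeWord.trapezoid 0 1 ρ σ • ∫ x in (0:ℝ)..1, LatticeWord.trapezoid 0 1 ρ x • K (L * (1 + σ - x)))
  have hin := integral_slot_subst (fun u => LatticeWord.trapezoid (t₀ - L) L ρ u • K (t₀ + L * σ - u)) (t₀ - L) L 1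
  rw [mul_one, show t₀ - L + L = t₀ by ring] at hin
  rw [trapezoid_affine hL, hin, smul_comm]
  congr 1
  congr 1
  refine intervalIntegral.integral_congr fun x _ => ?_
  show LatticeWord.trapezoid (t₀ - L) L ρ (t₀ - L + L * x) • K (t₀ + L * σ - (t₀ - L + L * x)) = _
  rw [trapezoid_affine hL]
  congr 1
  congr 1
  ring

/-! ## §2 Scalar bookkeeping for the two-slot double integral -/

/-- Real casts commute with the two-slot double integral. [folklore] -/
theorem pair_integral_integral_ofReal_mul (ρ : ℝ) (g : ℝ → ℝ → ℝ) :
    ∫ u in (0:ℝ)..1, ((LatticeWord.trapezoid 0 1 ρ u : ℝ) : ℂ) * ∫ x in (0:ℝ)..1, ((LatticeWord.trapezoid 0 1 ρ x : ℝ) : ℂ) * ((g u x : ℝ) : ℂ) =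
      (((∫ u in (0:ℝ)..1, LatticeWord.trapezoid 0 1 ρ u * ∫ x in (0:ℝ)..1, LatticeWord.trapezoid 0 1 ρ x * g u x : ℝ)) : ℂ) := by
  rw [← intervalIntegral.integral_ofReal]
  refine intervalIntegral.integral_congr fun u _ => ?_
  show ((LatticeWord.trapezoid 0 1 ρ u : ℝ) : ℂ) * ∫ x in (0:ℝ)..1, ((LatticeWord.trapezoid 0 1 ρ x : ℝ) : ℂ) * ((g u x : ℝ) : ℂ) =
    (((LatticeWord.trapezoid 0 1 ρ u * ∫ x in (0:ℝ)..1, LatticeWord.trapezoid 0 1 ρ x * g u x : ℝ)) : ℂ)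
  rw [Complex.ofReal_mul, ← intervalIntegral.integral_ofReal]
  congr 1
  refine intervalIntegral.integral_congr fun x _ => ?_
  show ((LatticeWord.trapezoid 0 1 ρ x : ℝ) : ℂ) * ((g u x : ℝ) : ℂ) = (((LatticeWord.trapezoid 0 1 ρ x * g u x : ℝ)) : ℂ)
  rw [Complex.ofReal_mul]

/-- Finite double sums with constant coefficients commute with the two-slot double integral (jointly continuous real kernels). [folklore] -/
theorem pair_integral_integral_sum_sum (ρ : ℝ) {g : Fin 3 → Fin 3 → ℝ → ℝ → ℝ} (hg : ∀ l k, Continuous (Function.uncurry (g l k)))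
    (c : Fin 3 → Fin 3 → ℂ) :
    ∫ u in (0:ℝ)..1, ((LatticeWord.trapezoid 0 1 ρ u : ℝ) : ℂ) * ∫ x in (0:ℝ)..1, ((LatticeWord.trapezoid 0 1 ρ x : ℝ) : ℂ) *
        ∑ l, ∑ k, c l k * ((g l k u x : ℝ) : ℂ) =
      ∑ l, ∑ k, c l k * ∫ u in (0:ℝ)..1, ((LatticeWord.trapezoid 0 1 ρ u : ℝ) : ℂ) * ∫ x in (0:ℝ)..1, ((LatticeWord.trapezoid 0 1 ρ x : ℝ) : ℂ) *
        ((g l k u x : ℝ) : ℂ) := by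
  have hac : Continuous fun s : ℝ => ((LatticeWord.trapezoid 0 1 ρ s : ℝ) : ℂ) := Complex.continuous_ofReal.comp (continuous_trapezoid_unit ρ)
  have hin : ∀ l k u, Continuous fun x : ℝ => ((LatticeWord.trapezoid 0 1 ρ x : ℝ) : ℂ) * ((g l k u x : ℝ) : ℂ) := fun l k u =>
    hac.mul (Complex.continuous_ofReal.comp ((hg l k).comp (continuous_const.prodMk continuous_id)))
  have hout : ∀ l k, Continuous fun u : ℝ => ((LatticeWord.trapezoid 0 1 ρ u : ℝ) : ℂ) *
      ∫ x in (0:ℝ)..1, ((LatticeWord.trapezoid 0 1 ρ x : ℝ) : ℂ) * ((g l k u x : ℝ) : ℂ) := by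
    intro l k
    have hf : Continuous (Function.uncurry fun u x : ℝ => ((LatticeWord.trapezoid 0 1 ρ x : ℝ) : ℂ) * ((g l k u x : ℝ) : ℂ)) :=
      (hac.comp continuous_snd).mul (Complex.continuous_ofReal.comp (hg l k))
    exact hac.mul (intervalIntegral.continuous_parametric_intervalIntegral_of_continuous' hf 0 1)
  have hinner : ∀ u, ∫ x in (0:ℝ)..1, ((LatticeWord.trapezoid 0 1 ρ x : ℝ) : ℂ) * ∑ l, ∑ k, c l k * ((g l k u x : ℝ) : ℂ) =
      ∑ l, ∑ k, c l k * ∫ x in (0:ℝ)..1, ((LatticeWord.trapezoid 0 1 ρ x : ℝ) : ℂ) * ((g l k u x : ℝ) : ℂ) := by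
    intro u
    rw [← integral_sum_sum_const_mul c (fun l k => hin l k u)]
    refine intervalIntegral.integral_congr fun x _ => ?_
    show ((LatticeWord.trapezoid 0 1 ρ x : ℝ) : ℂ) * ∑ l, ∑ k, c l k * ((g l k u x : ℝ) : ℂ) =
      ∑ l, ∑ k, c l k * (((LatticeWord.trapezoid 0 1 ρ x : ℝ) : ℂ) * ((g l k u x : ℝ) : ℂ))
    rw [Finset.mul_sum]
    refine Finset.sum_congr rfl fun l _ => ?_
    rw [Finset.mul_sum]
    refine Finset.sum_congr rfl fun k _ => ?_
    ring
  rw [← integral_sum_sum_const_mul c hout]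
  refine intervalIntegral.integral_congr fun u _ => ?_
  show ((LatticeWord.trapezoid 0 1 ρ u : ℝ) : ℂ) * (∫ x in (0:ℝ)..1, ((LatticeWord.trapezoid 0 1 ρ x : ℝ) : ℂ) * ∑ l, ∑ k, c l k * ((g l k u x : ℝ) : ℂ)) =
    ∑ l, ∑ k, c l k * (((LatticeWord.trapezoid 0 1 ρ u : ℝ) : ℂ) * ∫ x in (0:ℝ)..1, ((LatticeWord.trapezoid 0 1 ρ x : ℝ) : ℂ) * ((g l k u x : ℝ) : ℂ))
  rw [hinner u, Finset.mul_sum]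
  refine Finset.sum_congr rfl fun l _ => ?_
  rw [Finset.mul_sum]
  refine Finset.sum_congr rfl fun k _ => ?_
  ring

/-- Joint continuity of the pair kernel entries `(u, x) ↦ (exp(−(T(1+u−x))•B))_{ik}` (scalar-negated form). [folklore] -/
theorem continuous_pairKernel_apply' (T : ℝ) (B : Matrix (Fin 3) (Fin 3) ℝ) (i k : Fin 3) :
    Continuous fun p : ℝ × ℝ => (NormedSpace.exp (-(T * (1 + p.1 - p.2)) • B)) i k :=
  (continuous_exp_smul_apply B i k).comp (by fun_prop : Continuous fun p : ℝ × ℝ => -(T * (1 + p.1 - p.2)))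

/-! ## §3 The pair kernel is `T⁻¹ • pairResp · P̂` -/

set_option maxHeartbeats 400000 in
/-- **THE FRESH–FRESH PAIR KERNEL IS `pairResp` UP TO `T⁻¹`.**  For `𝔸 = ν•S`, a lattice phase `P` (`m = P.m`, `m̂ = mhat P`) and a slot length `L`
with `T = L·4π²ν|m|² ≠ 0`: `∫₀¹ a(σ) • ∫₀¹ a(x) • exp((L(1+σ−x))•(blockGen (ν•S) γ₁ m)↾ℝ)(P_m v) dx dσ = (T⁻¹ : ℂ) • cmat(pairResp ρ T (regBlock S m̂) · projPerp m̂) v`.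
[cite: MajdaKramer1999, §2.2.1.3 (cell problem (49))] [cite: Hale1980, Ch. III §1, Theorem 1.1] -/
theorem pair_integral_integral_exp_blockGen_eq (S : Torus.Visc4 (Fin 3)) (ν γ₁ : ℝ) (P : LatticePhase) (ρ : ℝ) {L : ℝ}
    (hT : L * (4 * Real.pi ^ 2 * ν * ‖latticeVec P.m‖ ^ 2) ≠ 0) (v : EuclideanSpace ℂ (Fin 3)) :
    ∫ u in (0:ℝ)..1, LatticeWord.trapezoid 0 1 ρ u • ∫ x in (0:ℝ)..1, LatticeWord.trapezoid 0 1 ρ x •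
        NormedSpace.exp ((L * (1 + u - x)) • (blockGen (ν • S) γ₁ P.m).restrictScalars ℝ) (transversalProj P.m v) =
      ((L * (4 * Real.pi ^ 2 * ν * ‖latticeVec P.m‖ ^ 2))⁻¹ : ℂ) •
        Matrix.toEuclideanCLM (n := Fin 3) (𝕜 := ℂ)
          ((pairResp ρ (L * (4 * Real.pi ^ 2 * ν * ‖latticeVec P.m‖ ^ 2)) (regBlock S (mhat P)) * projPerp (mhat P)).map ((↑) : ℝ → ℂ)) v := by
  have hTc : ((L : ℂ) * (4 * (Real.pi : ℂ) ^ 2 * (ν : ℂ) * ((‖latticeVec P.m‖ : ℝ) : ℂ) ^ 2)) ≠ 0 := by exact_mod_cast hT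
  set T : ℝ := L * (4 * Real.pi ^ 2 * ν * ‖latticeVec P.m‖ ^ 2) with hTdef
  set Bh := regBlock S (mhat P) with hBh
  set Ph := projPerp (mhat P) with hPh
  set Bℝ := (blockGen (ν • S) γ₁ P.m).restrictScalars ℝ with hBℝ
  have hK : ∀ σ : ℝ, ∀ i, NormedSpace.exp ((L * σ) • Bℝ) (transversalProj P.m v) i =
      ∑ l, ∑ k, ((Ph k l : ℂ) * v l) * (((NormedSpace.exp (-(T * σ) • Bh)) i k : ℝ) : ℂ) := by
    intro σ i
    rw [hBℝ, exp_blockGen_transversalProj_apply]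
    have e : -(L * σ * (4 * Real.pi ^ 2 * ν * ‖latticeVec P.m‖ ^ 2)) = -(T * σ) := by rw [hTdef]; ring
    rw [e]
    refine Finset.sum_congr rfl fun l _ => ?_
    simp only [Matrix.mul_apply, ← hBh, ← hPh]
    push_cast
    rw [Finset.sum_mul]
    exact Finset.sum_congr rfl fun k _ => by ring
  have hEc : Continuous fun σ : ℝ => NormedSpace.exp (σ • Bℝ) :=
    continuous_iff_continuousAt.2 fun σ => (hasDerivAt_exp_smul_const Bℝ σ).continuousAt
  have hKc : Continuous fun p : ℝ × ℝ => NormedSpace.exp ((L * (1 + p.1 - p.2)) • Bℝ) (transversalProj P.m v) :=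
    (hEc.comp (by fun_prop : Continuous fun p : ℝ × ℝ => L * (1 + p.1 - p.2))).clm_apply continuous_const
  have hinner_c : ∀ u, Continuous fun x : ℝ => LatticeWord.trapezoid 0 1 ρ x • NormedSpace.exp ((L * (1 + u - x)) • Bℝ) (transversalProj P.m v) :=
    fun u => (continuous_trapezoid_unit ρ).smul (hKc.comp (continuous_const.prodMk continuous_id))
  have houter_c : Continuous fun u : ℝ => LatticeWord.trapezoid 0 1 ρ u •
      ∫ x in (0:ℝ)..1, LatticeWord.trapezoid 0 1 ρ x • NormedSpace.exp ((L * (1 + u - x)) • Bℝ) (transversalProj P.m v) := by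
    have hf : Continuous (Function.uncurry fun u x : ℝ =>
        LatticeWord.trapezoid 0 1 ρ x • NormedSpace.exp ((L * (1 + u - x)) • Bℝ) (transversalProj P.m v)) :=
      ((continuous_trapezoid_unit ρ).comp continuous_snd).smul hKc
    exact (continuous_trapezoid_unit ρ).smul (intervalIntegral.continuous_parametric_intervalIntegral_of_continuous' hf 0 1)
  ext i
  rw [intervalIntegral_apply_coord (houter_c.intervalIntegrable _ _) i, PiLp.smul_apply, toEuclideanCLM_map_apply, smul_eq_mul]
  have hL : ∫ u in (0:ℝ)..1, (LatticeWord.trapezoid 0 1 ρ u •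
        ∫ x in (0:ℝ)..1, LatticeWord.trapezoid 0 1 ρ x • NormedSpace.exp ((L * (1 + u - x)) • Bℝ) (transversalProj P.m v)) i =
      ∫ u in (0:ℝ)..1, ((LatticeWord.trapezoid 0 1 ρ u : ℝ) : ℂ) * ∫ x in (0:ℝ)..1, ((LatticeWord.trapezoid 0 1 ρ x : ℝ) : ℂ) *
        ∑ l, ∑ k, ((Ph k l : ℂ) * v l) * (((NormedSpace.exp (-(T * (1 + u - x)) • Bh)) i k : ℝ) : ℂ) := by
    refine intervalIntegral.integral_congr fun u _ => ?_
    show (LatticeWord.trapezoid 0 1 ρ u • ∫ x in (0:ℝ)..1, LatticeWord.trapezoid 0 1 ρ x •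
        NormedSpace.exp ((L * (1 + u - x)) • Bℝ) (transversalProj P.m v)) i = _
    rw [PiLp.smul_apply, intervalIntegral_apply_coord ((hinner_c u).intervalIntegrable _ _) i, Complex.real_smul]
    congr 1
    refine intervalIntegral.integral_congr fun x _ => ?_
    show (LatticeWord.trapezoid 0 1 ρ x • NormedSpace.exp ((L * (1 + u - x)) • Bℝ) (transversalProj P.m v)) i = _
    rw [PiLp.smul_apply, Complex.real_smul, hK (1 + u - x) i]
  rw [hL, pair_integral_integral_sum_sum ρ (g := fun _ k u x => (NormedSpace.exp (-(T * (1 + u - x)) • Bh)) i k)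
    (fun _ k => continuous_pairKernel_apply' T Bh i k) (fun l k => (Ph k l : ℂ) * v l)]
  rw [Finset.mul_sum]
  refine Finset.sum_congr rfl fun l _ => ?_
  simp only [Matrix.mul_apply]
  push_cast
  rw [Finset.sum_mul, Finset.mul_sum]
  refine Finset.sum_congr rfl fun k _ => ?_
  rw [pair_integral_integral_ofReal_mul ρ (fun u x => (NormedSpace.exp (-(T * (1 + u - x)) • Bh)) i k)]
  have hq : pairResp ρ T Bh i k = T * ∫ u in (0:ℝ)..1, LatticeWord.trapezoid 0 1 ρ u *
      ∫ x in (0:ℝ)..1, LatticeWord.trapezoid 0 1 ρ x * (NormedSpace.exp (-((T * (1 + u - x)) • Bh))) i k := rfl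
  have hq' : pairResp ρ T Bh i k = T * ∫ u in (0:ℝ)..1, LatticeWord.trapezoid 0 1 ρ u *
      ∫ x in (0:ℝ)..1, LatticeWord.trapezoid 0 1 ρ x * (NormedSpace.exp (-(T * (1 + u - x)) • Bh)) i k := by
    rw [hq]; simp only [neg_smul]
  have hTc' : ((T : ℝ) : ℂ) = (L : ℂ) * (4 * (Real.pi : ℂ) ^ 2 * (ν : ℂ) * ((‖latticeVec P.m‖ : ℝ) : ℂ) ^ 2) := by
    rw [hTdef]; push_cast; ring
  have hT' : ((T : ℝ) : ℂ) ≠ 0 := by exact_mod_cast hT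
  rw [hq', ← hTc']
  push_cast
  rw [inv_mul_eq_div, eq_div_iff hT']
  ring

end Summit.AnomalousDissipation.AnomalousDissipation.Theorems.SolenoidalFractalHomogenisation.LagrangianStep.Sideband

end
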